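import Summits.QuantumFields.YangMills.Theorems.UnitScaleTiltHalvingP1FlatCoreFrameLin
import HarnessLib

/-!
# Route `UnitScaleTilt`, crux K1 child «MinimiserStabilityRegPr» (stmt-QuantumFields-19200), stub V2′ `stub_halvingStep` — pillar P1♭, brick **J4a (tower half)**
# of the LEAD plan `T2FLAT-PLAN-v1.1-addendum-w5g4.md` (19200 evidence #46): **THE EFFECTIVE COARSE GAUGE MAP OF A GAUGE COPY UNDER THE DOUBLE-BAR TOWER —
# EXACT RECURSION, AND ONE STEP OF ITS LOGARITHM = BLOCK SITE-AVERAGE + SMALL-LIPSCHITZ REMAINDER**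
# ([Balaban1985Averaging] (89) p.31, (92)∕(97)–(100) pp.31–32, (110) p.34; [Balaban1985RegularSpaces] Sect. E p.95)

Cell `ym3-torus` (HUMAN RULING D-0037: YM₃ on T³ is ladder rung R3, not the Clay problem), LEAD seat `ym-ust-19200-w5` gen 4.
`--supports stmt-QuantumFields-19200 --as helper`; def-free, 0 sorry, standard axioms.  Nothing here claims the stub, the crux or the gap.

WHY (plan v1.1 J4).  For a pre-gauged field `W` (near `1` on the window) and a SMALL fine gauge map `h`, the double-bar tower of the copy `W^{h}` is the tower of `W`
acted on by an EFFECTIVE level-`i` gauge map `κ_i(h)`: `U̿^{(i)}(W^{h}) = (U̿^{(i)}W)^{κ_i}`, with the EXACT recursion `κ₀ = h`,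
`κ_{i+1}(y) = v((U̿^{(i)}W)^{κ_i})(y)⁻¹ · κ_i(emb y) · v(U̿^{(i)}W)(y)` (§1; (89) `U̿ = (Ū)^{v⁻¹}` + the covariance (11) of the single bar).  The top normalisation (o) of the P1♭
`core` is an equation on `κ_k(h)` (plan §2 F-b); §2 shows that ONE step of `log κ` is `siteAvg (log κ_i) + Θ` with `‖Θ‖ ≤ 700(δ+ℓ)·ℓ`-type bounds and `Θ` small-Lipschitz in
`log κ_i` (✓p624918 `norm_mlog_gbarStep_sub_mean_le`∕`_lipschitz` + one more BCH step with the frame exponent `Φ = log v(U̿^{(i)}W)(y)`), so that by induction `log κ_k = siteAvgIter_k (log h) +`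
(small Lipschitz) — print's top restriction `Q′_k λ` up to Sect. E's change of variables (J4b∕J4c consume these letters level by level; the induction itself is bookkeeping of
the sup sizes and is left to the J4c file, which fixes the windows).

WHAT IS PROVED (generic complete normed `ℂ`-algebra `𝔸`, any `P : Params`):
* §1 ★ `dbarIterU_gaugeActT_eq_effGauge` — for ANY `κ : (i : ℕ) → GaugeTransf P i 𝔸ˣ` obeying the displayed recursion from `κ 0 = h`: `dbarIterU i (gaugeActT h W) =
  gaugeActT (κ i) (dbarIterU i W)` for all `i` (no smallness); `exists_effGauge` (the recursion defines such a family); `coe_dbarIterU_gaugeActT_eq_effGauge` (bond values).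
* §2 ★★ `norm_mlog_effGaugeStep_sub_siteAvg_le` — one step: for a level-`j` field `X` with `‖X(Γ_{y,x_i}) − 1‖ ≤ δ` on the block of `y`, `κ = exp ∘ l` with `‖l‖ ≤ ℓ` at the
  centre and the stair ends, `2δ + 2ℓ ≤ 1/100`: `‖log( v(X^{κ})(y)⁻¹ · κ(emb y) · v(X)(y) ) − siteAvg l y‖ ≤ 100(2δ+2ℓ)ℓ + 3(6δ+ 2ℓ)²·…` packaged as `≤ 700(δ + ℓ)·ℓ`.
HONEST SCOPE: exact algebra + one analytic step; the k-fold induction with explicit windows is J4c's; constants not optimised.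

References: T. Bałaban, CMP **98** (1985) 17–51 [Balaban1985Averaging]; CMP **99** (1985) 75–102 [Balaban1985RegularSpaces] (Sect. E p.95); CMP **109** (1987) 249–301 [Balaban1987RG1] ((0.3)–(0.8)).
-/

set_option autoImplicit false

noncomputable section

namespace Summit.QuantumFields.YangMills.Theorems.P1FlatCoreFrameLinTower

open NormedSpace
open Literature.MathematicalPhysics.QuantumFieldTheory.Balaban1983to89
open T4Continuum BlockAveraging ExpMeanLog MatrixLog
open B10Eq27TorusAxialLog (holT gaugeActT gaugeActT_apply)
open B7TransferAnalyticMean (meanCLM meanCLM_apply norm_meanCLM_apply_le)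
open B12Membership313II (bchLog exp_bchLog norm_bchRem_le norm_expMul_sub_one_lt_one)
open Summit.QuantumFields.YangMills.Theorems.Prop8Chart (emlAvgU emlAvgU_gaugeActT holT_gaugeActT)
open Summit.QuantumFields.YangMills.Theorems.Prop8ChartDoubleBar (vframeU coe_vframeU dbarAvgU dbarAvgU_eq_gaugeActT dbarAvgU_gaugeActT dbarIterU dbarIterU_zero
  dbarIterU_succ gaugeActT_gaugeActT gaugeActT_const_one)
open Summit.QuantumFields.YangMills.Theorems.P1FlatCoreFrameLinBCH (norm_meanCLM_le_of_forall_le)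
open Summit.QuantumFields.YangMills.Theorems.P1FlatCoreFrameLin (coe_vframeU_eq_exp_meanCLM mlog_inv_vframeU_gaugeActT_mul_eq mlog_inv_vframeU_eq
  norm_mlog_gbarStep_sub_mean_le meanCLM_stairEnd_eq_siteAvg)

variable {P : Params} {𝔸 : Type*} [NormedRing 𝔸] [NormedAlgebra ℂ 𝔸] [CompleteSpace 𝔸]

/-! ## §1 The effective coarse gauge map: exact recursion -/

section Algebra

/-- **THE DOUBLE-BAR TOWER OF A GAUGE COPY IS THE TOWER ACTED ON BY THE EFFECTIVE GAUGE MAP**: for any family `κ i : T^{(i)} → 𝔸ˣ` with `κ 0 = h` and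
`κ (i+1) y = v((U̿^{(i)}W)^{κ i})(y)⁻¹ · κ i (emb y) · v(U̿^{(i)}W)(y)`, `U̿^{(i)}(W^{h}) = (U̿^{(i)}W)^{κ i}` for every `i` — (89) `U̿ = (Ū)^{v⁻¹}` twice and the
covariance (11) of the single bar; NO smallness. [cite: Balaban1985Averaging, (89) p.31, (11) p.19, (92) p.31, (97)-(100) p.32] -/
theorem dbarIterU_gaugeActT_eq_effGauge (W : GaugeField P 0 𝔸ˣ) (h : GaugeTransf P 0 𝔸ˣ) (κ : (i : ℕ) → GaugeTransf P i 𝔸ˣ) (h0 : κ 0 = h)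
    (hs : ∀ (i : ℕ) (y : Site P (i + 1)),
      κ (i + 1) y = (vframeU (gaugeActT (κ i) (dbarIterU i W)) y)⁻¹ * κ i (emb y) * vframeU (dbarIterU i W) y) :
    ∀ i : ℕ, dbarIterU i (gaugeActT h W) = gaugeActT (κ i) (dbarIterU i W)
  | 0 => by rw [dbarIterU_zero, dbarIterU_zero, h0]
  | i + 1 => by
    have ih := dbarIterU_gaugeActT_eq_effGauge W h κ h0 hs i
    rw [dbarIterU_succ, dbarIterU_succ, ih, dbarAvgU_gaugeActT]
    -- `emlAvgU X = (dbarAvgU X)^{v(X)}`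
    have hX : emlAvgU (dbarIterU i W) = gaugeActT (fun y : Site P (i + 1) => vframeU (dbarIterU i W) y) (dbarAvgU (dbarIterU i W)) := by
      rw [dbarAvgU_eq_gaugeActT, gaugeActT_gaugeActT]
      have : (fun x : Site P (i + 1) => vframeU (dbarIterU i W) x * (vframeU (dbarIterU i W) x)⁻¹) = fun _ => 1 := by
        funext x; rw [mul_inv_cancel]
      rw [this, gaugeActT_const_one]
    rw [hX, gaugeActT_gaugeActT]
    congr 1
    funext y
    rw [hs i y, mul_assoc]

/-- **THE EFFECTIVE GAUGE FAMILY EXISTS** (the recursion defines it). [cite: Balaban1985Averaging, (97) p.32] -/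
theorem exists_effGauge (W : GaugeField P 0 𝔸ˣ) (h : GaugeTransf P 0 𝔸ˣ) :
    ∃ κ : (i : ℕ) → GaugeTransf P i 𝔸ˣ, κ 0 = h ∧
      (∀ (i : ℕ) (y : Site P (i + 1)), κ (i + 1) y = (vframeU (gaugeActT (κ i) (dbarIterU i W)) y)⁻¹ * κ i (emb y) * vframeU (dbarIterU i W) y) ∧
      ∀ i : ℕ, dbarIterU i (gaugeActT h W) = gaugeActT (κ i) (dbarIterU i W) := by
  let κ : (i : ℕ) → GaugeTransf P i 𝔸ˣ := fun i => Nat.rec (motive := fun i => GaugeTransf P i 𝔸ˣ) h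
    (fun i κi y => (vframeU (gaugeActT κi (dbarIterU i W)) y)⁻¹ * κi (emb y) * vframeU (dbarIterU i W) y) i
  have h0 : κ 0 = h := rfl
  have hs : ∀ (i : ℕ) (y : Site P (i + 1)),
      κ (i + 1) y = (vframeU (gaugeActT (κ i) (dbarIterU i W)) y)⁻¹ * κ i (emb y) * vframeU (dbarIterU i W) y := fun _ _ => rfl
  exact ⟨κ, h0, hs, dbarIterU_gaugeActT_eq_effGauge W h κ h0 hs⟩

/-- bond values: `U̿^{(i)}(W^{h})(c) = κ i (c₋) · U̿^{(i)}W(c) · (κ i (c₊))⁻¹`. [cite: Balaban1985Averaging, (92) p.31] -/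
theorem coe_dbarIterU_gaugeActT_eq_effGauge (W : GaugeField P 0 𝔸ˣ) (h : GaugeTransf P 0 𝔸ˣ) (κ : (i : ℕ) → GaugeTransf P i 𝔸ˣ) (h0 : κ 0 = h)
    (hs : ∀ (i : ℕ) (y : Site P (i + 1)),
      κ (i + 1) y = (vframeU (gaugeActT (κ i) (dbarIterU i W)) y)⁻¹ * κ i (emb y) * vframeU (dbarIterU i W) y) (i : ℕ) (c : PBond P i) :
    ((dbarIterU i (gaugeActT h W) c : 𝔸ˣ) : 𝔸) = ((κ i c.src : 𝔸ˣ) : 𝔸) * ((dbarIterU i W c : 𝔸ˣ) : 𝔸) * (((κ i c.tgt)⁻¹ : 𝔸ˣ) : 𝔸) := by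
  rw [dbarIterU_gaugeActT_eq_effGauge W h κ h0 hs i, gaugeActT_apply, Units.val_mul, Units.val_mul]

end Algebra

/-! ## §2 One step of `log κ`: the block site-average plus a small remainder -/

section Step

variable {j : ℕ}

open LatticeFieldCalculus (siteAvg)

/-- **★★ ONE STEP OF THE EFFECTIVE GAUGE MAP IN LOG COORDINATES**: for a level-`j` field `X` with `‖X(Γ_{y,x_i}) − 1‖ ≤ δ` (every centre stair of the block of `y`) and a
level-`j` gauge map `κ = exp ∘ l` with `‖l‖ ≤ ℓ` at the centre and the stair ends, `2δ + 2ℓ ≤ 1/100`: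
`‖log( v(X^{κ})(y)⁻¹ · κ(emb y) · v(X)(y) ) − siteAvg l y‖ ≤ 700(δ + ℓ)·ℓ` — the next level's `log κ` IS the block site-average of this level's, to first order, with NO
contribution of the centre value (✓`norm_mlog_gbarStep_sub_mean_le` + ✓`meanCLM_stairEnd_eq_siteAvg` + one BCH step absorbing the frame exponent `Φ`, `‖Φ‖ ≤ 2δ`:
`bchLog (−Φ + avg + Θ) Φ = avg + Θ + O((δ+ℓ)²)`). [cite: Balaban1985RegularSpaces, Sect. E p.95; Balaban1985Averaging, (97) p.32, (110) p.34] -/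
theorem norm_mlog_effGaugeStep_sub_siteAvg_le (X : GaugeField P j 𝔸ˣ) (κ : GaugeTransf P j 𝔸ˣ) (l : Site P j → 𝔸)
    (hκ : ∀ x, (κ x : 𝔸) = exp (l x)) (y : Site P (j + 1)) {δ ℓ : ℝ} (hδ : 0 ≤ δ)
    (hH : ∀ i : Idx P, ‖((holT X (emb y) (stairWord i.2.1 (off i.1)) : 𝔸ˣ) : 𝔸) - 1‖ ≤ δ)
    (ha : ‖l (emb y)‖ ≤ ℓ) (hb : ∀ i : Idx P, ‖l (walkEnd (emb y) (stairWord i.2.1 (off i.1)))‖ ≤ ℓ) (hs : 2 * δ + 2 * ℓ ≤ 1 / 100) :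
    ‖mlog ((((vframeU (gaugeActT κ X) y)⁻¹ * κ (emb y) * vframeU X y : 𝔸ˣ) : 𝔸)) - siteAvg l y‖ ≤ 700 * (δ + ℓ) * ℓ := by
  have hℓ : 0 ≤ ℓ := (norm_nonneg _).trans ha
  -- the frame exponent `Φ`
  set Φ : 𝔸 := meanCLM (Idx P) 𝔸 fun i : Idx P => mlog ((holT X (emb y) (stairWord i.2.1 (off i.1)) : 𝔸ˣ) : 𝔸) with hΦ
  have hZ : ∀ i : Idx P, ‖mlog ((holT X (emb y) (stairWord i.2.1 (off i.1)) : 𝔸ˣ) : 𝔸)‖ ≤ 2 * δ := fun i =>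
    (norm_mlog_le_two_mul ((hH i).trans (by linarith))).trans (by linarith [hH i])
  have hΦn : ‖Φ‖ ≤ 2 * δ := norm_meanCLM_le_of_forall_le _ (by positivity) hZ
  have hvX : ((vframeU X y : 𝔸ˣ) : 𝔸) = exp Φ := coe_vframeU_eq_exp_meanCLM X y
  -- `G := v(X^κ)(y)⁻¹ κ(emb y) = exp F`, `F` within `100(2δ+2ℓ)ℓ` of `−Φ + avg`
  set avg : 𝔸 := meanCLM (Idx P) 𝔸 fun i : Idx P => l (walkEnd (emb y) (stairWord i.2.1 (off i.1))) with havg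
  have havgn : ‖avg‖ ≤ ℓ := norm_meanCLM_le_of_forall_le _ hℓ hb
  set F : 𝔸 := mlog ((((vframeU (gaugeActT κ X) y)⁻¹ * κ (emb y) : 𝔸ˣ) : 𝔸)) with hF
  have hFest : ‖F - (-Φ + avg)‖ ≤ 100 * (2 * δ + 2 * ℓ) * ℓ := by
    have h := norm_mlog_gbarStep_sub_mean_le X κ l hκ y hδ hH ha hb hs
    rw [mlog_inv_vframeU_eq X y hδ (by linarith) hH] at h
    exact h
  have hFn : ‖F‖ ≤ 2 * δ + 2 * ℓ := by
    have : ‖-Φ + avg‖ ≤ 2 * δ + ℓ := (norm_add_le _ _).trans (by rw [norm_neg]; linarith)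
    calc ‖F‖ = ‖(F - (-Φ + avg)) + (-Φ + avg)‖ := by rw [sub_add_cancel]
      _ ≤ ‖F - (-Φ + avg)‖ + ‖-Φ + avg‖ := norm_add_le _ _
      _ ≤ 100 * (2 * δ + 2 * ℓ) * ℓ + (2 * δ + ℓ) := by linarith
      _ ≤ 2 * δ + 2 * ℓ := by nlinarith
  -- `G = exp F`: the unit `v(X^κ)(y)⁻¹ κ(emb y)` is within 1 of `1` (so `exp (mlog ·) = ·`)
  have hG : ((((vframeU (gaugeActT κ X) y)⁻¹ * κ (emb y) : 𝔸ˣ) : 𝔸)) = exp F := by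
    -- from ✓`mlog_inv_vframeU_gaugeActT_mul_eq` the value is `exp(−m)·exp a` with small exponents; redo it through `exp_bchLog`
    have hval : ((((vframeU (gaugeActT κ X) y)⁻¹ * κ (emb y) : 𝔸ˣ) : 𝔸)) =
        exp (-(meanCLM (Idx P) 𝔸 fun i : Idx P => bchLog (l (emb y))
          (bchLog (mlog ((holT X (emb y) (stairWord i.2.1 (off i.1)) : 𝔸ˣ) : 𝔸)) (-(l (walkEnd (emb y) (stairWord i.2.1 (off i.1)))))))) * exp (l (emb y)) := by
      rw [Units.val_mul, B7Prop1Explicit.units_val_inv_eq_exp_neg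
        (P1FlatCoreFrameLin.coe_vframeU_gaugeActT_eq_exp X κ l hκ y hδ hH ha hb hs), hκ]
    -- the exponent `m` is small: each `bchLog a (bchLog Z (−b))` has norm ≤ 4(2δ+2ℓ)
    set mneg : 𝔸 := -(meanCLM (Idx P) 𝔸 fun i : Idx P => bchLog (l (emb y))
          (bchLog (mlog ((holT X (emb y) (stairWord i.2.1 (off i.1)) : 𝔸ˣ) : 𝔸)) (-(l (walkEnd (emb y) (stairWord i.2.1 (off i.1))))))) with hmneg
    have hmn : ‖mneg‖ ≤ 4 * (2 * δ + 2 * ℓ) := by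
      rw [hmneg, norm_neg]
      refine norm_meanCLM_le_of_forall_le _ (by positivity) fun i => ?_
      set Z := mlog ((holT X (emb y) (stairWord i.2.1 (off i.1)) : 𝔸ˣ) : 𝔸)
      set b := l (walkEnd (emb y) (stairWord i.2.1 (off i.1)))
      have h8 : ‖Z‖ + ‖-b‖ ≤ 1 / 8 := by rw [norm_neg]; linarith [hZ i, hb i]
      have h0 : 0 ≤ ‖Z‖ + ‖-b‖ := by positivity
      have hle : ‖Z‖ + ‖-b‖ ≤ 2 * δ + 2 * ℓ := by rw [norm_neg]; linarith [hZ i, hb i]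
      have hY : ‖bchLog Z (-b)‖ ≤ 2 * (2 * δ + 2 * ℓ) := by
        have hsq : 3 * (‖Z‖ + ‖-b‖) ^ 2 ≤ 2 * δ + 2 * ℓ := by nlinarith
        calc ‖bchLog Z (-b)‖ = ‖(bchLog Z (-b) - (Z + -b)) + (Z + -b)‖ := by rw [sub_add_cancel]
          _ ≤ ‖bchLog Z (-b) - (Z + -b)‖ + ‖Z + -b‖ := norm_add_le _ _
          _ ≤ 3 * (‖Z‖ + ‖-b‖) ^ 2 + (‖Z‖ + ‖-b‖) := by gcongr; exacts [norm_bchRem_le h8, norm_add_le _ _]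
          _ ≤ 2 * (2 * δ + 2 * ℓ) := by linarith
      have h8' : ‖l (emb y)‖ + ‖bchLog Z (-b)‖ ≤ 1 / 8 := by linarith
      have h0' : 0 ≤ ‖l (emb y)‖ + ‖bchLog Z (-b)‖ := by positivity
      have hsq' : 3 * (‖l (emb y)‖ + ‖bchLog Z (-b)‖) ^ 2 ≤ 2 * δ + 2 * ℓ := by nlinarith
      calc ‖bchLog (l (emb y)) (bchLog Z (-b))‖
          = ‖(bchLog (l (emb y)) (bchLog Z (-b)) - (l (emb y) + bchLog Z (-b))) + (l (emb y) + bchLog Z (-b))‖ := by rw [sub_add_cancel]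
        _ ≤ ‖bchLog (l (emb y)) (bchLog Z (-b)) - (l (emb y) + bchLog Z (-b))‖ + ‖l (emb y) + bchLog Z (-b)‖ := norm_add_le _ _
        _ ≤ 3 * (‖l (emb y)‖ + ‖bchLog Z (-b)‖) ^ 2 + (‖l (emb y)‖ + ‖bchLog Z (-b)‖) := by gcongr; exacts [norm_bchRem_le h8', norm_add_le _ _]
        _ ≤ 4 * (2 * δ + 2 * ℓ) := by linarith
    have hm : ‖mneg‖ + ‖l (emb y)‖ ≤ 1 / 4 := by linarith
    rw [hval, ← exp_bchLog (norm_expMul_sub_one_lt_one hm), hF, hval, ← exp_bchLog (norm_expMul_sub_one_lt_one hm)]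
    -- `mlog (exp B) = B` for the small `B := bchLog (−m) a`
    congr 1
    refine (B7BlockAvgLog.mlog_exp ?_).symm
    have h8 : ‖mneg‖ + ‖l (emb y)‖ ≤ 1 / 8 := by linarith
    have h0 : 0 ≤ ‖mneg‖ + ‖l (emb y)‖ := by positivity
    have hrem := norm_bchRem_le h8
    have hlog2 : (1 : ℝ) / 2 < Real.log 2 := by linarith [Real.log_two_gt_d9]
    calc ‖bchLog mneg (l (emb y))‖ = ‖(bchLog mneg (l (emb y)) - (mneg + l (emb y))) + (mneg + l (emb y))‖ := by rw [sub_add_cancel]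
      _ ≤ ‖bchLog mneg (l (emb y)) - (mneg + l (emb y))‖ + ‖mneg + l (emb y)‖ := norm_add_le _ _
      _ ≤ 3 * (‖mneg‖ + ‖l (emb y)‖) ^ 2 + (‖mneg‖ + ‖l (emb y)‖) := by gcongr; exact norm_add_le _ _
      _ < Real.log 2 := by nlinarith
  -- the product: `G · v(X)(y) = exp F · exp Φ = exp (bchLog F Φ)`
  have hFΦ : ‖F‖ + ‖Φ‖ ≤ 1 / 4 := by linarith
  have hprod : ((((vframeU (gaugeActT κ X) y)⁻¹ * κ (emb y) * vframeU X y : 𝔸ˣ) : 𝔸)) = exp (bchLog F Φ) := by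
    rw [Units.val_mul, hG, hvX, exp_bchLog (norm_expMul_sub_one_lt_one hFΦ)]
  -- `mlog` of it
  have hBn : ‖bchLog F Φ‖ ≤ 1 / 2 := by
    have h8 : ‖F‖ + ‖Φ‖ ≤ 1 / 8 := by linarith
    have h0 : 0 ≤ ‖F‖ + ‖Φ‖ := by positivity
    calc ‖bchLog F Φ‖ = ‖(bchLog F Φ - (F + Φ)) + (F + Φ)‖ := by rw [sub_add_cancel]
      _ ≤ ‖bchLog F Φ - (F + Φ)‖ + ‖F + Φ‖ := norm_add_le _ _
      _ ≤ 3 * (‖F‖ + ‖Φ‖) ^ 2 + (‖F‖ + ‖Φ‖) := by gcongr; exacts [norm_bchRem_le h8, norm_add_le _ _]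
      _ ≤ 1 / 2 := by nlinarith
  rw [hprod, B7BlockAvgLog.mlog_exp (hBn.trans_lt (by linarith [Real.log_two_gt_d9]))]
  -- `bchLog F Φ − avg = (bchLog F Φ − (F + Φ)) + (F − (−Φ + avg))`
  have halg : bchLog F Φ - siteAvg l y = (bchLog F Φ - (F + Φ)) + (F - (-Φ + avg)) := by
    rw [havg, meanCLM_stairEnd_eq_siteAvg]; abel
  rw [halg]
  have h8 : ‖F‖ + ‖Φ‖ ≤ 1 / 8 := by linarith
  have h0 : 0 ≤ ‖F‖ + ‖Φ‖ := by positivity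
  have hrem : ‖bchLog F Φ - (F + Φ)‖ ≤ 3 * (‖F‖ + ‖Φ‖) ^ 2 := norm_bchRem_le h8
  -- but we need the remainder to be O((δ+ℓ)·ℓ): use the Lipschitz BCH bound against the point `(F₀, Φ)` with `F₀ := −Φ` (where `bchLog (−Φ) Φ − 0 = 0`)
  have hlip := B12Membership313II.norm_bchRem_sub_bchRem_le (X₁ := F) (Y₁ := Φ) (X₂ := -Φ) (Y₂ := Φ) (a := 2 * δ + 2 * ℓ) (a' := 2 * δ)
    hFn (by rw [norm_neg]; linarith) hΦn hΦn (by linarith)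
  have hzero : bchLog (-Φ) Φ - (-Φ + Φ) = 0 := by
    rw [neg_add_cancel, sub_zero]
    have hΦlt : ‖Φ‖ + ‖Φ‖ ≤ 1 / 4 := by linarith
    -- `exp(−Φ) exp Φ = 1`, `bchLog (−Φ) Φ = logOnePlus 0 = 0`
    letI : NormedAlgebra ℚ 𝔸 := NormedAlgebra.restrictScalars ℚ ℂ 𝔸
    have : exp (-Φ) * exp Φ = 1 := by rw [← exp_add_of_commute (Commute.refl Φ).neg_left, neg_add_cancel, exp_zero]
    rw [bchLog, this, sub_self, Literature.Analysis.Complex.logOnePlus_zero]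
  rw [hzero, sub_zero, sub_self, norm_zero, add_zero] at hlip
  have hFd : ‖F - -Φ‖ ≤ 100 * (2 * δ + 2 * ℓ) * ℓ + ℓ := by
    calc ‖F - -Φ‖ = ‖(F - (-Φ + avg)) + avg‖ := by congr 1; abel
      _ ≤ ‖F - (-Φ + avg)‖ + ‖avg‖ := norm_add_le _ _
      _ ≤ 100 * (2 * δ + 2 * ℓ) * ℓ + ℓ := by linarith
  have hsum200 : 200 * (δ + ℓ) ≤ 1 := by linarith
  have hFd2 : ‖F - -Φ‖ ≤ 2 * ℓ := by nlinarith [mul_nonneg (by positivity : (0:ℝ) ≤ δ + ℓ) hℓ]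
  have hlip2 : ‖bchLog F Φ - (F + Φ)‖ ≤ 24 * (δ + ℓ) * ℓ := by
    have h4 : 3 * (2 * δ + 2 * ℓ + 2 * δ) ≤ 12 * (δ + ℓ) := by linarith
    have h0 : 0 ≤ 3 * (2 * δ + 2 * ℓ + 2 * δ) := by positivity
    calc ‖bchLog F Φ - (F + Φ)‖ ≤ 3 * (2 * δ + 2 * ℓ + 2 * δ) * ‖F - -Φ‖ := hlip
      _ ≤ 12 * (δ + ℓ) * (2 * ℓ) := by gcongr
      _ = 24 * (δ + ℓ) * ℓ := by ring
  have hsecond : ‖F - (-Φ + avg)‖ ≤ 200 * (δ + ℓ) * ℓ := by linarith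
  calc ‖bchLog F Φ - (F + Φ) + (F - (-Φ + avg))‖ ≤ ‖bchLog F Φ - (F + Φ)‖ + ‖F - (-Φ + avg)‖ := norm_add_le _ _
    _ ≤ 24 * (δ + ℓ) * ℓ + 200 * (δ + ℓ) * ℓ := by linarith
    _ ≤ 700 * (δ + ℓ) * ℓ := by nlinarith [mul_nonneg (by positivity : (0:ℝ) ≤ δ + ℓ) hℓ]

end Step

/-! ## §3 (v1.1) The EXACT step through `eml` of the RELATIVE gauge factors — every `W`-dependence in one factor

For the k-fold induction in log-RELATIVE currency (★w3-19936 g6's design): one step of the effective gauge is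
`κ_{j+1}(y) = κ_j(ȳ) · eml_i(hol_i · s_i)⁻¹ · eml_i(hol_i)`, `ȳ = emb y`, `hol_i` the centre stairs of `X_j = U̿^{(j)}W`,
`s_i = κ_j(x_i)⁻¹κ_j(ȳ)` the relative factors — exact, no smallness; at `hol ≡ 1` it is the `W`-free step
`κ_j(ȳ)·eml_i(s_i)⁻¹`, and in general the `W`-dependence is the single factor `G = eml(s)·eml(hol·s)⁻¹·eml(hol)` (`= 1` when
`hol ≡ 1` or `s ≡ 1`). -/

section Relative

variable {j : ℕ}

/-- **THE FRAME OF A GAUGE COPY, CONJUGATION FORM**: `v(X^{κ})(y) = κ(ȳ) · eml_i( X(Γ_{ȳ,x_i}) · κ(x_i)⁻¹κ(ȳ) ) · κ(ȳ)⁻¹` — the stair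
transporters of `X^{κ}` are `κ(ȳ)·X(Γ)·κ(x_i)⁻¹` (✓`holT_gaugeActT`) and `exp[mean log]` is conjugation-covariant (✓`eml_conj`).
[cite: Balaban1985Averaging, (8) p.19, (110) p.34] -/
theorem coe_vframeU_gaugeActT_eq_conj_eml (X : GaugeField P j 𝔸ˣ) (κ : GaugeTransf P j 𝔸ˣ) (y : Site P (j + 1)) :
    ((vframeU (gaugeActT κ X) y : 𝔸ˣ) : 𝔸) =
      ((κ (emb y) : 𝔸ˣ) : 𝔸) *
        eml (fun i : Idx P => ((holT X (emb y) (stairWord i.2.1 (off i.1)) : 𝔸ˣ) : 𝔸) *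
          (((κ (walkEnd (emb y) (stairWord i.2.1 (off i.1))))⁻¹ * κ (emb y) : 𝔸ˣ) : 𝔸)) *
        (((κ (emb y))⁻¹ : 𝔸ˣ) : 𝔸) := by
  rw [coe_vframeU]
  have hfam : (fun i : Idx P => ((holT (gaugeActT κ X) (emb y) (stairWord i.2.1 (off i.1)) : 𝔸ˣ) : 𝔸)) =
      fun i : Idx P => ((κ (emb y) : 𝔸ˣ) : 𝔸) * (((holT X (emb y) (stairWord i.2.1 (off i.1)) : 𝔸ˣ) : 𝔸) *
          (((κ (walkEnd (emb y) (stairWord i.2.1 (off i.1))))⁻¹ * κ (emb y) : 𝔸ˣ) : 𝔸)) * (((κ (emb y))⁻¹ : 𝔸ˣ) : 𝔸) := by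
    funext i
    rw [holT_gaugeActT, Units.val_mul, Units.val_mul, Units.val_mul]
    simp only [mul_assoc, Units.mul_inv, mul_one]
  rw [hfam, eml_conj (Units.mul_inv _) (Units.inv_mul _)]

/-- The same as an identity of units: `v(X^{κ})(y) = κ(ȳ) · [eml_i(hol_i·s_i)] · κ(ȳ)⁻¹`. [cite: Balaban1985Averaging, (110) p.34] -/
theorem vframeU_gaugeActT_eq_conj_emlUnit (X : GaugeField P j 𝔸ˣ) (κ : GaugeTransf P j 𝔸ˣ) (y : Site P (j + 1)) :
    vframeU (gaugeActT κ X) y =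
      κ (emb y) *
        (isUnit_eml (fun i : Idx P => ((holT X (emb y) (stairWord i.2.1 (off i.1)) : 𝔸ˣ) : 𝔸) *
          (((κ (walkEnd (emb y) (stairWord i.2.1 (off i.1))))⁻¹ * κ (emb y) : 𝔸ˣ) : 𝔸))).unit *
        (κ (emb y))⁻¹ := by
  apply Units.ext
  rw [coe_vframeU_gaugeActT_eq_conj_eml, Units.val_mul, Units.val_mul, IsUnit.unit_spec]

/-- **THE EXACT STEP THROUGH THE RELATIVE FACTORS**: for the effective gauges of (97)/(100),
`κ_{j+1}(y) = κ_j(ȳ) · [eml_i(hol_i · s_i)]⁻¹ · v(X_j)(y)`, `X_j = U̿^{(j)}W`, `s_i = κ_j(x_i)⁻¹κ_j(ȳ)`, `v(X_j)(y) = eml_i(hol_i)` —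
no smallness, every `W`-dependence explicit. [cite: Balaban1985Averaging, (97)-(100) p.32, (110) p.34] -/
theorem effGauge_step_eq_eml (W : GaugeField P 0 𝔸ˣ) (κ : (i : ℕ) → GaugeTransf P i 𝔸ˣ)
    (hs : ∀ (i : ℕ) (y : Site P (i + 1)),
      κ (i + 1) y = (vframeU (gaugeActT (κ i) (dbarIterU i W)) y)⁻¹ * κ i (emb y) * vframeU (dbarIterU i W) y)
    (i : ℕ) (y : Site P (i + 1)) :
    κ (i + 1) y =
      κ i (emb y) *
        ((isUnit_eml (fun idx : Idx P => ((holT (dbarIterU i W) (emb y) (stairWord idx.2.1 (off idx.1)) : 𝔸ˣ) : 𝔸) *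
          (((κ i (walkEnd (emb y) (stairWord idx.2.1 (off idx.1))))⁻¹ * κ i (emb y) : 𝔸ˣ) : 𝔸))).unit)⁻¹ *
        vframeU (dbarIterU i W) y := by
  rw [hs i y, vframeU_gaugeActT_eq_conj_emlUnit, mul_inv_rev, mul_inv_rev, inv_inv]
  group

/-- **THE SAME WITH THE `W`-FACTOR ISOLATED**: `κ_{j+1}(y) = κ_j(ȳ) · eml_i(s_i)⁻¹ · G`, `G := eml_i(s_i) · eml_i(hol_i·s_i)⁻¹ · eml_i(hol_i)`
(so `G = 1` when the stairs are trivial — the `W`-free relative step — and when `s ≡ 1`). [cite: Balaban1985Averaging, (97)-(100) p.32, (110) p.34] -/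
theorem effGauge_step_eq_eml_G (W : GaugeField P 0 𝔸ˣ) (κ : (i : ℕ) → GaugeTransf P i 𝔸ˣ)
    (hs : ∀ (i : ℕ) (y : Site P (i + 1)),
      κ (i + 1) y = (vframeU (gaugeActT (κ i) (dbarIterU i W)) y)⁻¹ * κ i (emb y) * vframeU (dbarIterU i W) y)
    (i : ℕ) (y : Site P (i + 1)) :
    κ (i + 1) y =
      κ i (emb y) *
        (isUnit_eml (fun idx : Idx P =>
          (((κ i (walkEnd (emb y) (stairWord idx.2.1 (off idx.1))))⁻¹ * κ i (emb y) : 𝔸ˣ) : 𝔸))).unit⁻¹ *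
        ((isUnit_eml (fun idx : Idx P =>
            (((κ i (walkEnd (emb y) (stairWord idx.2.1 (off idx.1))))⁻¹ * κ i (emb y) : 𝔸ˣ) : 𝔸))).unit *
          ((isUnit_eml (fun idx : Idx P => ((holT (dbarIterU i W) (emb y) (stairWord idx.2.1 (off idx.1)) : 𝔸ˣ) : 𝔸) *
            (((κ i (walkEnd (emb y) (stairWord idx.2.1 (off idx.1))))⁻¹ * κ i (emb y) : 𝔸ˣ) : 𝔸))).unit)⁻¹ *
          vframeU (dbarIterU i W) y) := by
  rw [effGauge_step_eq_eml W κ hs i y]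
  group

/-- **TRIVIAL STAIRS ⇒ THE `W`-FREE RELATIVE STEP**: if the centre stairs of `X_j` in the block of `y` are `1`, then
`κ_{j+1}(y) = κ_j(ȳ) · eml_i(κ_j(x_i)⁻¹κ_j(ȳ))⁻¹`. [cite: Balaban1985Averaging, (97)-(100) p.32, (110) p.34] -/
theorem effGauge_step_eq_eml_of_stairs (W : GaugeField P 0 𝔸ˣ) (κ : (i : ℕ) → GaugeTransf P i 𝔸ˣ)
    (hs : ∀ (i : ℕ) (y : Site P (i + 1)),
      κ (i + 1) y = (vframeU (gaugeActT (κ i) (dbarIterU i W)) y)⁻¹ * κ i (emb y) * vframeU (dbarIterU i W) y)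
    (i : ℕ) (y : Site P (i + 1)) (h : ∀ idx : Idx P, holT (dbarIterU i W) (emb y) (stairWord idx.2.1 (off idx.1)) = 1) :
    κ (i + 1) y =
      κ i (emb y) *
        (isUnit_eml (fun idx : Idx P =>
          (((κ i (walkEnd (emb y) (stairWord idx.2.1 (off idx.1))))⁻¹ * κ i (emb y) : 𝔸ˣ) : 𝔸))).unit⁻¹ := by
  rw [effGauge_step_eq_eml W κ hs i y]
  have h1 : (fun idx : Idx P => ((holT (dbarIterU i W) (emb y) (stairWord idx.2.1 (off idx.1)) : 𝔸ˣ) : 𝔸) *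
      (((κ i (walkEnd (emb y) (stairWord idx.2.1 (off idx.1))))⁻¹ * κ i (emb y) : 𝔸ˣ) : 𝔸)) =
      fun idx : Idx P => (((κ i (walkEnd (emb y) (stairWord idx.2.1 (off idx.1))))⁻¹ * κ i (emb y) : 𝔸ˣ) : 𝔸) := by
    funext idx; rw [h idx, Units.val_one, one_mul]
  have hv : vframeU (dbarIterU i W) y = 1 := by
    apply Units.ext
    rw [coe_vframeU, Units.val_one]
    have h2 : (fun idx : Idx P => ((holT (dbarIterU i W) (emb y) (stairWord idx.2.1 (off idx.1)) : 𝔸ˣ) : 𝔸)) = fun _ => 1 := by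
      funext idx; rw [h idx, Units.val_one]
    rw [h2, Prop8Chart.eml_const_one]
  rw [hv, mul_one]
  congr 2
  exact Units.ext (by rw [IsUnit.unit_spec, IsUnit.unit_spec, h1])

end Relative

end Summit.QuantumFields.YangMills.Theorems.P1FlatCoreFrameLinTower

end
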